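import Literature.Computability.QuantumComplexity.BQP
import Literature.Computability.QuantumComplexity.BQPSubsetPP
import Literature.Computability.QuantumComplexity.SimUniformity
import Literature.Computability.QuantumComplexity.ClassicalClassesProofs
import Literature.Computability.Complexity.ProbabilisticClassesProofs
import HarnessLib

/-!
# The sandwich `P ⊆ BPP ⊆ BQP ⊆ PP ⊆ PSPACE` (quantum-advantage.S06) — discharges

Sibling proof file of `QuantumComplexity/BQP.lean` (D-0014: named facts `def X : Prop` are
discharged as `theorem X_holds : X`). All four inclusions of the classical sandwich around `BQP`
(Bernstein–Vazirani 1997, §8; Adleman–DeMarrais–Huang 1997) are theorems of the tree: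

* `P ⊆ BPP` — `P_subset_BPP_holds` (`Complexity/ProbabilisticClassesProofs.lean`);
* `BPP ⊆ BQP` — `BPP_subset_BQP_holds` (Bernstein–Vazirani 1997, Thm. 8.3;
  `QuantumComplexity/SimUniformity.lean` with `BQPProofs.lean`);
* `BQP ⊆ PP` — `BQP_subset_PP_holds` (Adleman–DeMarrais–Huang 1997, Thm. 6.4;
  `QuantumComplexity/BQPSubsetPP.lean`);
* `PP ⊆ PSPACE` — `PP_subset_PSPACE_holds` (Gill 1977, Prop. 5.2(i);
  `QuantumComplexity/ClassicalClassesProofs.lean`, `Complexity/SpaceProofs.lean`).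

Discharged here: `bqp_containments_holds : bqp_containments` (the conjunction, quantum-advantage.S06)
and `BQP_subset_PSPACE_holds : BQP_subset_PSPACE` (Bernstein–Vazirani 1997, Thm. 8.4, here as the
corollary `BQP ⊆ PP ⊆ PSPACE`).

## References

* E. Bernstein, U. Vazirani, *Quantum complexity theory*, SIAM J. Comput. 26 (1997) 1411–1473
  [BernsteinVazirani1997], §8: Thm. 8.3 (`BPP ⊆ BQP`), Thm. 8.4 (`BQP ⊆ PSPACE`), Thm. 8.6
  (`BQP ⊆ P^{#P}`).
* L. Adleman, J. DeMarrais, M.-D. Huang, *Quantum computability*, SIAM J. Comput. 26 (1997)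
  1524–1540 [AdlemanDeMarraisHuang1997], Thm. 6.4 (`BQP ⊆ PP`).
* J. Gill, *Computational complexity of probabilistic Turing machines*, SIAM J. Comput. 6 (1977)
  675–695 [Gill1977], Prop. 5.2(i) (`PP ⊆ PSPACE`).
-/

namespace Literature.Computability.QuantumComplexity

open Literature.Computability.Complexity

/-- **`BQP ⊆ PSPACE`** — discharge of the named fact `BQP_subset_PSPACE` (`BQP.lean`), as
`BQP ⊆ PP ⊆ PSPACE`. [cite: BernsteinVazirani1997, §8 (Thm. 8.4, BQP ⊆ PSPACE)] -/
theorem BQP_subset_PSPACE_holds : BQP_subset_PSPACE := fun _ h =>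
  PP_subset_PSPACE_holds (BQP_subset_PP_holds h)

/-- **quantum-advantage.S06, the sandwich `P ⊆ BPP ⊆ BQP ⊆ PP ⊆ PSPACE`** — discharge of the named
fact `bqp_containments` (`BQP.lean`). [cite: BernsteinVazirani1997, §8] -/
theorem bqp_containments_holds : bqp_containments :=
  ⟨P_subset_BPP_holds, BPP_subset_BQP_holds, BQP_subset_PP_holds, PP_subset_PSPACE_holds⟩

end Literature.Computability.QuantumComplexity
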